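import Summits.QuantumFields.BalabanUV.Beta.GAN24.PsiSlotDefectOfDivergences
import Summits.QuantumFields.BalabanUV.Beta.GAN24.PsiLegDefectOfDivergences
import Summits.QuantumFields.BalabanUV.Beta.SymCorrectorSockets

/-!
# `BalabanUV.Beta.GAN24.PsiTableDefectOfDivergences` — binder row G-an2-4 ∕ (CONV-C), W-slot, TRANSFER-III: **THE FULL Ψ-DEFECT OF A BI-TABLE — TWO SOURCE SLOTS AND TWO KERNEL
# LEGS TRANSPORTED — IS `LocStencil₂` BY ITS FOUR SINGLE-DIVERGENCE LETTER ROWS** (the composite of `GAN24/PsiSlotDefectOfDivergences` and `GAN24/PsiLegDefectOfDivergences`; (C-6)'s first lemma,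
# sizing note v0.5 §7–§8).  The table transport is the TREE's: `𝒯₂ Z := α x ↦ slotPsiS r n (slotPsiS r n Z α x)` (d1-formalise-leaf-03 `SymCorrectorPair.vertex2OfK_conj_psiKS`, TT5
# `SymCorrectorSockets.locStencil₂_slotPsiS₂`), then the leg congruence `Y ↦ Ψ̂ᵀ ∘ (Y ∘ Ψ̂)` entrywise (road-P2 g55 M.45 ∕ M.46's `𝒯′`).

NOT IN PRINT; OUR BOOKKEEPING (G-an2-4 crux team (2), leaf prover `b2b-balaban-gan24-formalise-leaf-03`, gen 79; one docstring reworded by gen 80).  [folklore] bookkeeping BY NAME; 0 `def`, 0 cited facts,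
0 `def … : Prop`, 0 sorry.
HONEST FRAMING (cell contract, verbatim): «discharging `BetaPertH` makes Bałaban's UV stability UNCONDITIONAL — a real constructive-QFT result; it is NOT the continuum limit and NOT the Clay
problem.»  HONEST DEPENDENCY (verbatim): «continuum YM on T⁴ ⇐ BetaPertH ∧ nine spine estimates (0/9 proved); BetaPertH ⇐ (D1) ∧ (D4) ∧ CAP+tail; G-an2-4 gates asym, D1 and NE2/3/4.»

CONTENTS (generic `d`; `0 < n`; `r ∈ box (d+1) n`; `0 ≤ δ`; `Ψ̂ := psiKS r n`):
* §1 BRIDGES — `faceSum_add_fun`, `faceSum_const_mul_fun`, `faceSum_comm` (scalar face sums in different variables commute), `slotPsiS_comm_scalar`, **`slotPsiS₂_eq_slotPsiS_fst_snd`**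
  (the tree's function-valued `slotPsiS r n (slotPsiS r n Z κ u) κ′ u′` = `PsiSlotDefectOfDivergences` §3's evaluated form; leaf-05 g85's X-PSDD DOCFIX-1), `slotPsiS_map` (a linear entry
  operation commutes with the slot transport).
* §2 **`locStencil₂_slotPsiS₂_sub_self_of_divergence_rows'`** — `PsiSlotDefectOfDivergences` §3 in the tree's form; **`locStencil₂_legRow_slotPsiS₂`**-type lemmas: the two LEG letter rows
  SURVIVE `𝒯₂` (the leg letters are linear entry operations: `slotPsiS_map` twice + TT5 `locStencil₂_slotPsiS₂`).
* §3 **`locStencil₂_psiTable_sub_self_of_divergence_rows`**: from the FOUR rows `h₂ h₁ hL₁ hL₂` (MY g66 `HalfMemberCellOfDivergences` binders VERBATIM),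
  `LocStencil₂ (κ u κ′ u′ ↦ Ψ̂ᵀ ∘ (𝒯₂ Z κ u κ′ u′ ∘ Ψ̂) − Z κ u κ′ u′) (K₄) δ` with an explicit `K₄(C₁, C₂, C_{L1}, C_{L2}; faceWtSum, n, δ, d)` — the (III′) cell's table-transport
  defect is fed by the (α-0) chain's four letters (the OWNER gan24-p1 g46's W-4 (2)).
WHAT THIS IS NOT: NOT the cell rows ((C-6) needs road-P2's `lin4` conjugation (C-1) and leaf-01's `lin4` shape on top), NOT a letter at the comb data, NOT a value; the (III′) campaign is NOT
asked (an2 W-4); zero weight; NEVER «G-an2-4 closed» as (CONV-C); NOT D1, NOT `BetaPertH`, NOT continuum, NOT Clay.  2026-08-25.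
-/

noncomputable section

open Finset
open scoped BigOperators
open Literature.MathematicalPhysics.QuantumFieldTheory
open Literature.MathematicalPhysics.QuantumFieldTheory.Balaban1983to89
open Literature.MathematicalPhysics.QuantumFieldTheory.Balaban1983to89.Beta
open ExpKernelCalculus (MKer Site BiLoc comp)
open OneStepResolventKernel (Fib)
open KernelWard (divV)
open AffineAveraging (box unitVec)
open AveragingContours (blk)
open BalabanCompositeJets (LocStencil₂)
open BalabanStepW2 (locStencil₂_add')
open Summit.QuantumFields.BalabanUV.Beta.TameKernelCalculus (trK)
open Summit.QuantumFields.BalabanUV.Beta.SymCorrectorKernel (psiKS)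
open Summit.QuantumFields.BalabanUV.Beta.SymCorrectorFace (faceWt faceSum slotPsiS faceWtSum faceWtSum_nonneg)
open Summit.QuantumFields.BalabanUV.Beta.SymCorrectorSockets (locStencil₂_slotPsiS₂)
open Summit.QuantumFields.BalabanUV.Beta.GAN24.PsiSlotDefectOfDivergences (locStencil₂_slotPsiS₂_sub_self_of_divergence_rows)
open Summit.QuantumFields.BalabanUV.Beta.GAN24.PsiLegDefectOfDivergences (locStencil₂_legConj_sub_self_of_divergence_rows)

namespace Summit.QuantumFields.BalabanUV.Beta.GAN24.PsiTableDefectOfDivergences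

variable {d : ℕ} {n : ℕ} (hn : 0 < n) {r : Fin (d + 1) → ℕ} (hr : r ∈ box (d + 1) n)

/-! ## §1 Bridges -/

omit hn hr in
/-- [folklore] Pointwise additivity of the scalar face sum. -/
theorem faceSum_add_fun (a b : Fin (d + 1) → Site (d + 1) → ℝ) (Y : Site (d + 1)) :
    faceSum n (fun κ u => a κ u + b κ u) Y = faceSum n a Y + faceSum n b Y := by
  simp only [faceSum, smul_eq_mul, mul_add, Finset.sum_add_distrib]

omit hn hr in
/-- [folklore] Pointwise homogeneity of the scalar face sum. -/
theorem faceSum_const_mul_fun (c : ℝ) (a : Fin (d + 1) → Site (d + 1) → ℝ) (Y : Site (d + 1)) :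
    faceSum n (fun κ u => c * a κ u) Y = c * faceSum n a Y := by
  simp only [faceSum, smul_eq_mul, Finset.mul_sum]
  exact Finset.sum_congr rfl fun _ _ => Finset.sum_congr rfl fun _ _ => by ring

omit hn hr in
/-- [folklore] **SCALAR FACE SUMS IN DIFFERENT VARIABLES COMMUTE.** -/
theorem faceSum_comm (f : Fin (d + 1) → Site (d + 1) → Fin (d + 1) → Site (d + 1) → ℝ) (Y Y' : Site (d + 1)) :
    faceSum n (fun κ₂ u₂ => faceSum n (fun κ₁ u₁ => f κ₁ u₁ κ₂ u₂) Y) Y' = faceSum n (fun κ₁ u₁ => faceSum n (fun κ₂ u₂ => f κ₁ u₁ κ₂ u₂) Y') Y := by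
  simp only [SymCorrectorFace.faceSum_eq_sum_sigma, smul_eq_mul, Finset.mul_sum]
  rw [Finset.sum_comm]
  exact Finset.sum_congr rfl fun _ _ => Finset.sum_congr rfl fun _ _ => by ring

omit hn hr in
/-- [folklore] **SCALAR SLOT TRANSPORTS ON DIFFERENT VARIABLES COMMUTE.** -/
theorem slotPsiS_comm_scalar (f : Fin (d + 1) → Site (d + 1) → Fin (d + 1) → Site (d + 1) → ℝ)
    (κ : Fin (d + 1)) (u : Site (d + 1)) (κ' : Fin (d + 1)) (u' : Site (d + 1)) :
    slotPsiS r n (fun κ₂ u₂ => slotPsiS r n (fun κ₁ u₁ => f κ₁ u₁ κ₂ u₂) κ u) κ' u'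
      = slotPsiS r n (fun κ₁ u₁ => slotPsiS r n (fun κ₂ u₂ => f κ₁ u₁ κ₂ u₂) κ' u') κ u := by
  simp only [slotPsiS, smul_eq_mul, faceSum_add_fun, faceSum_const_mul_fun]
  rw [faceSum_comm (n := n) f (blk n u) (blk n u')]
  ring

omit hn hr in
/-- [folklore] **SLOT-ORDER BRIDGE** (leaf-05 g85's X-PSDD DOCFIX-1): the tree's function-valued double transport `slotPsiS r n (slotPsiS r n Z κ u) κ′ u′` (first slot inside, as in
d1-formalise-leaf-03's `SymCorrectorPair.vertex2OfK_conj_psiKS` ∕ TT5 `locStencil₂_slotPsiS₂`) EQUALS `PsiSlotDefectOfDivergences` §3's evaluated form. -/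
theorem slotPsiS₂_eq_slotPsiS_fst_snd (Z : Fin (d + 1) → Site (d + 1) → Fin (d + 1) → Site (d + 1) → MKer (d + 1) (Fib d))
    (κ : Fin (d + 1)) (u : Site (d + 1)) (κ' : Fin (d + 1)) (u' : Site (d + 1)) :
    slotPsiS r n (slotPsiS r n Z κ u) κ' u' = slotPsiS r n (fun κ₁ u₁ => slotPsiS r n (fun κ₂ u₂ => Z κ₁ u₁ κ₂ u₂) κ' u') κ u := by
  funext x z a b
  have e1 : slotPsiS r n (slotPsiS r n Z κ u) κ' u' x z a b
      = slotPsiS r n (fun κ₂ u₂ => slotPsiS r n (fun κ₁ u₁ => Z κ₁ u₁ κ₂ u₂ x z a b) κ u) κ' u' := by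
    simp only [slotPsiS, faceSum, Pi.add_apply, Pi.smul_apply, Finset.sum_apply, smul_eq_mul]
  have e2 : slotPsiS r n (fun κ₁ u₁ => slotPsiS r n (fun κ₂ u₂ => Z κ₁ u₁ κ₂ u₂) κ' u') κ u x z a b
      = slotPsiS r n (fun κ₁ u₁ => slotPsiS r n (fun κ₂ u₂ => Z κ₁ u₁ κ₂ u₂ x z a b) κ' u') κ u := by
    simp only [slotPsiS, faceSum, Pi.add_apply, Pi.smul_apply, Finset.sum_apply, smul_eq_mul]
  rw [e1, e2, slotPsiS_comm_scalar]

omit hn hr in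
/-- [folklore] **A LINEAR ENTRY OPERATION COMMUTES WITH THE SLOT TRANSPORT** (any modules `E E′`, `L : E →ₗ[ℝ] E′`): `slotPsiS r n (κ u ↦ L (T κ u)) α x = L (slotPsiS r n T α x)`.
THE PUBLIC HOME of this generic bridge (one home; road-P2 W-5 l.65494, leaf-04 g76 I-DUP1 ∕ N-TD2): road-P2 g55's `GAN24.CombWilsonStepPush` (M.49 v1.1, landed) carries the same
statement as a `private theorem` for its own use only — consumers take THIS copy BY NAME (kept here so that this file does not import the Wilson-sector closure of `CombWilsonStepPush`). -/
theorem slotPsiS_map {E E' : Type*} [AddCommGroup E] [Module ℝ E] [AddCommGroup E'] [Module ℝ E'] (L : E →ₗ[ℝ] E') (T : Fin (d + 1) → Site (d + 1) → E)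
    (α : Fin (d + 1)) (x : Site (d + 1)) :
    slotPsiS r n (fun κ u => L (T κ u)) α x = L (slotPsiS r n T α x) := by
  simp only [slotPsiS, faceSum, map_add, map_smul, map_sum]

/-! ## §2 The slot defect in the tree's form; the leg letters survive the slot transports -/

include hn in
omit hr in
/-- [folklore] **THE DEFECT OF THE DOUBLE SLOT TRANSPORT, TREE FORM**: `PsiSlotDefectOfDivergences.locStencil₂_slotPsiS₂_sub_self_of_divergence_rows` read through the slot-order bridge. -/
theorem locStencil₂_slotPsiS₂_sub_self_of_divergence_rows'
    (Z : Fin (d + 1) → Site (d + 1) → Fin (d + 1) → Site (d + 1) → MKer (d + 1) (Fib d)) {C₁ C₂ δ : ℝ} (hδ : 0 ≤ δ)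
    (h₁ : LocStencil₂ (fun (_ : Fin (d + 1)) (p : Site (d + 1)) (κ' : Fin (d + 1)) (u' : Site (d + 1)) => divV (fun κ₁ u₁ => Z κ₁ u₁ κ' u') p) C₁ δ)
    (h₂ : LocStencil₂ (fun (κ : Fin (d + 1)) (u : Site (d + 1)) (_ : Fin (d + 1)) (p : Site (d + 1)) => divV (fun κ₁ u₁ => Z κ u κ₁ u₁) p) C₂ δ) :
    LocStencil₂ (fun κ u κ' u' => slotPsiS r n (slotPsiS r n Z κ u) κ' u' - Z κ u κ' u')
      (faceWtSum r n * (((n : ℝ) ^ (d + 1)) * (Real.exp (3 * δ * (((d : ℝ) + 1) * n))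
          * (C₁ + faceWtSum r n * (((d : ℝ) + 1) * ((2 * (n : ℝ) ^ (d + 1)) * (Real.exp (δ * (((d : ℝ) + 1) * n)) * C₁))))))
        + faceWtSum r n * (((n : ℝ) ^ (d + 1)) * (Real.exp (δ * (((d : ℝ) + 1) * n)) * C₂))) δ := by
  intro κ u κ' u'
  have h := locStencil₂_slotPsiS₂_sub_self_of_divergence_rows hn r Z hδ h₁ h₂ κ u κ' u'
  change BiLoc (slotPsiS r n (slotPsiS r n Z κ u) κ' u' - Z κ u κ' u') u u _ δ
  rw [slotPsiS₂_eq_slotPsiS_fst_snd]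
  exact h

include hn in
omit hr in
/-- [folklore] **THE FIRST-LEG LETTER ROW SURVIVES THE DOUBLE SLOT TRANSPORT**: the first-leg divergence is a LINEAR ENTRY operation, so it commutes with `𝒯₂` (`slotPsiS_map` twice) and TT5
`locStencil₂_slotPsiS₂` carries its row (constant × `(1 + F·e^{3δ(d+1)n})·(1 + F·e^{δ(d+1)n})`, `F = faceWtSum·(d+1)·2n^{d+1}`). -/
theorem locStencil₂_legLeftRow_slotPsiS₂
    (Z : Fin (d + 1) → Site (d + 1) → Fin (d + 1) → Site (d + 1) → MKer (d + 1) (Fib d)) {CL₁ δ : ℝ} (hδ : 0 ≤ δ)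
    (hL₁ : LocStencil₂ (fun κ u κ' u' => fun (p z : Site (d + 1)) (_ : Fib d) (b : Fib d) =>
      ∑ β : Fin (d + 1), (Z κ u κ' u' p z (Sum.inl β) b - Z κ u κ' u' (p - unitVec β) z (Sum.inl β) b)) CL₁ δ) :
    LocStencil₂ (fun κ u κ' u' => fun (p z : Site (d + 1)) (_ : Fib d) (b : Fib d) =>
      ∑ β : Fin (d + 1), (slotPsiS r n (slotPsiS r n Z κ u) κ' u' p z (Sum.inl β) b - slotPsiS r n (slotPsiS r n Z κ u) κ' u' (p - unitVec β) z (Sum.inl β) b))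
      (CL₁ * (1 + faceWtSum r n * (((d + 1 : ℕ) : ℝ) * (2 * (n : ℝ) ^ (d + 1))) * Real.exp (δ * (3 * (((d + 1 : ℕ) : ℝ) * n))))
        * (1 + faceWtSum r n * (((d + 1 : ℕ) : ℝ) * (2 * (n : ℝ) ^ (d + 1))) * Real.exp (δ * (((d + 1 : ℕ) : ℝ) * n)))) δ := by
  -- the first-leg divergence as a linear map on kernels
  let L : MKer (d + 1) (Fib d) →ₗ[ℝ] MKer (d + 1) (Fib d) :=
    { toFun := fun Y => fun p z (_ : Fib d) b => ∑ β : Fin (d + 1), (Y p z (Sum.inl β) b - Y (p - unitVec β) z (Sum.inl β) b)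
      map_add' := fun Y Y' => by
        funext p z a b
        simp only [Pi.add_apply, Finset.sum_add_distrib.symm]
        exact Finset.sum_congr rfl fun β _ => by ring
      map_smul' := fun c Y => by
        funext p z a b
        simp only [Pi.smul_apply, smul_eq_mul, RingHom.id_apply, Finset.mul_sum]
        exact Finset.sum_congr rfl fun β _ => by ring }
  have hT := locStencil₂_slotPsiS₂ hn r (S₂ := fun κ u κ' u' => L (Z κ u κ' u')) hL₁ hδ
  have e : (fun κ u κ' u' => fun (p z : Site (d + 1)) (_ : Fib d) (b : Fib d) =>
        ∑ β : Fin (d + 1), (slotPsiS r n (slotPsiS r n Z κ u) κ' u' p z (Sum.inl β) b - slotPsiS r n (slotPsiS r n Z κ u) κ' u' (p - unitVec β) z (Sum.inl β) b))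
      = fun κ u => slotPsiS r n (slotPsiS r n (fun κ u κ' u' => L (Z κ u κ' u')) κ u) := by
    funext κ u κ' u'
    show L (slotPsiS r n (slotPsiS r n Z κ u) κ' u') = _
    rw [← slotPsiS_map (n := n) (r := r) L (slotPsiS r n Z κ u) κ' u']
    congr 1
    funext κ₂ u₂
    -- `L ((slotPsiS r n Z κ u) κ₂ u₂) = slotPsiS r n (L ∘∘ Z) κ u κ₂ u₂`: evaluation at `κ₂ u₂` is linear, and `slotPsiS_map` with the post-composition map
    let ev : (Fin (d + 1) → Site (d + 1) → MKer (d + 1) (Fib d)) →ₗ[ℝ] MKer (d + 1) (Fib d) :=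
      { toFun := fun W => L (W κ₂ u₂), map_add' := fun W W' => by simp only [Pi.add_apply, map_add], map_smul' := fun c W => by simp only [Pi.smul_apply, map_smul, RingHom.id_apply] }
    have h1 := slotPsiS_map (n := n) (r := r) ev Z κ u
    -- h1 : slotPsiS r n (fun κ₁ u₁ => ev (Z κ₁ u₁)) κ u = ev (slotPsiS r n Z κ u)
    have h2 : slotPsiS r n (fun κ u κ' u' => L (Z κ u κ' u')) κ u κ₂ u₂ = slotPsiS r n (fun κ₁ u₁ => ev (Z κ₁ u₁)) κ u := by
      simp only [slotPsiS, faceSum, Pi.add_apply, Pi.smul_apply, Finset.sum_apply]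
      rfl
    rw [h2, h1]
    rfl
  rw [e]
  exact hT

include hn in
omit hr in
/-- [folklore] **THE SECOND-LEG LETTER ROW SURVIVES THE DOUBLE SLOT TRANSPORT** (the second-leg divergence is a linear entry operation; `slotPsiS_map` twice + TT5). -/
theorem locStencil₂_legRightRow_slotPsiS₂
    (Z : Fin (d + 1) → Site (d + 1) → Fin (d + 1) → Site (d + 1) → MKer (d + 1) (Fib d)) {CL₂ δ : ℝ} (hδ : 0 ≤ δ)
    (hL₂ : LocStencil₂ (fun κ u κ' u' => fun (x p : Site (d + 1)) (a : Fib d) (_ : Fib d) =>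
      ∑ β : Fin (d + 1), (Z κ u κ' u' x p a (Sum.inl β) - Z κ u κ' u' x (p - unitVec β) a (Sum.inl β))) CL₂ δ) :
    LocStencil₂ (fun κ u κ' u' => fun (x p : Site (d + 1)) (a : Fib d) (_ : Fib d) =>
      ∑ β : Fin (d + 1), (slotPsiS r n (slotPsiS r n Z κ u) κ' u' x p a (Sum.inl β) - slotPsiS r n (slotPsiS r n Z κ u) κ' u' x (p - unitVec β) a (Sum.inl β)))
      (CL₂ * (1 + faceWtSum r n * (((d + 1 : ℕ) : ℝ) * (2 * (n : ℝ) ^ (d + 1))) * Real.exp (δ * (3 * (((d + 1 : ℕ) : ℝ) * n))))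
        * (1 + faceWtSum r n * (((d + 1 : ℕ) : ℝ) * (2 * (n : ℝ) ^ (d + 1))) * Real.exp (δ * (((d + 1 : ℕ) : ℝ) * n)))) δ := by
  let L : MKer (d + 1) (Fib d) →ₗ[ℝ] MKer (d + 1) (Fib d) :=
    { toFun := fun Y => fun x p a (_ : Fib d) => ∑ β : Fin (d + 1), (Y x p a (Sum.inl β) - Y x (p - unitVec β) a (Sum.inl β))
      map_add' := fun Y Y' => by
        funext x p a b
        simp only [Pi.add_apply, Finset.sum_add_distrib.symm]
        exact Finset.sum_congr rfl fun β _ => by ring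
      map_smul' := fun c Y => by
        funext x p a b
        simp only [Pi.smul_apply, smul_eq_mul, RingHom.id_apply, Finset.mul_sum]
        exact Finset.sum_congr rfl fun β _ => by ring }
  have hT := locStencil₂_slotPsiS₂ hn r (S₂ := fun κ u κ' u' => L (Z κ u κ' u')) hL₂ hδ
  have e : (fun κ u κ' u' => fun (x p : Site (d + 1)) (a : Fib d) (_ : Fib d) =>
        ∑ β : Fin (d + 1), (slotPsiS r n (slotPsiS r n Z κ u) κ' u' x p a (Sum.inl β) - slotPsiS r n (slotPsiS r n Z κ u) κ' u' x (p - unitVec β) a (Sum.inl β)))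
      = fun κ u => slotPsiS r n (slotPsiS r n (fun κ u κ' u' => L (Z κ u κ' u')) κ u) := by
    funext κ u κ' u'
    show L (slotPsiS r n (slotPsiS r n Z κ u) κ' u') = _
    rw [← slotPsiS_map (n := n) (r := r) L (slotPsiS r n Z κ u) κ' u']
    congr 1
    funext κ₂ u₂
    let ev : (Fin (d + 1) → Site (d + 1) → MKer (d + 1) (Fib d)) →ₗ[ℝ] MKer (d + 1) (Fib d) :=
      { toFun := fun W => L (W κ₂ u₂), map_add' := fun W W' => by simp only [Pi.add_apply, map_add], map_smul' := fun c W => by simp only [Pi.smul_apply, map_smul, RingHom.id_apply] }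
    have h1 := slotPsiS_map (n := n) (r := r) ev Z κ u
    have h2 : slotPsiS r n (fun κ u κ' u' => L (Z κ u κ' u')) κ u κ₂ u₂ = slotPsiS r n (fun κ₁ u₁ => ev (Z κ₁ u₁)) κ u := by
      simp only [slotPsiS, faceSum, Pi.add_apply, Pi.smul_apply, Finset.sum_apply]
      rfl
    rw [h2, h1]
    rfl
  rw [e]
  exact hT

/-! ## §3 The full transport: two slots, then the two kernel legs -/

include hn hr in
/-- [folklore] **THE FULL Ψ-DEFECT OF A BI-TABLE IS `LocStencil₂` BY ITS FOUR SINGLE-DIVERGENCE LETTER ROWS** (any `Z`, `0 < n`, `r ∈ box (d+1) n`, `0 ≤ δ`): with the tree's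
`𝒯₂ Z κ u κ′ u′ := slotPsiS r n (slotPsiS r n Z κ u) κ′ u′` and the leg congruence `Y ↦ Ψ̂ᵀ ∘ (Y ∘ Ψ̂)`, the four rows `h₁ h₂ hL₁ hL₂` (MY g66 binders VERBATIM) give
`LocStencil₂ (κ u κ′ u′ ↦ Ψ̂ᵀ ∘ (𝒯₂ Z κ u κ′ u′ ∘ Ψ̂) − Z κ u κ′ u′) K₄ δ`, `K₄` explicit — `PsiLegDefectOfDivergences` §2's two-leg defect on the table `𝒯₂ Z` fed by §2's transported
leg rows, plus §2's slot defect (`(leg ∘ 𝒯₂) Z − Z = (leg (𝒯₂ Z) − 𝒯₂ Z) + (𝒯₂ Z − Z)`). -/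
theorem locStencil₂_psiTable_sub_self_of_divergence_rows
    (Z : Fin (d + 1) → Site (d + 1) → Fin (d + 1) → Site (d + 1) → MKer (d + 1) (Fib d)) {C₁ C₂ CL₁ CL₂ δ : ℝ} (hδ : 0 ≤ δ)
    (h₁ : LocStencil₂ (fun (_ : Fin (d + 1)) (p : Site (d + 1)) (κ' : Fin (d + 1)) (u' : Site (d + 1)) => divV (fun κ₁ u₁ => Z κ₁ u₁ κ' u') p) C₁ δ)
    (h₂ : LocStencil₂ (fun (κ : Fin (d + 1)) (u : Site (d + 1)) (_ : Fin (d + 1)) (p : Site (d + 1)) => divV (fun κ₁ u₁ => Z κ u κ₁ u₁) p) C₂ δ)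
    (hL₁ : LocStencil₂ (fun κ u κ' u' => fun (p z : Site (d + 1)) (_ : Fib d) (b : Fib d) =>
      ∑ β : Fin (d + 1), (Z κ u κ' u' p z (Sum.inl β) b - Z κ u κ' u' (p - unitVec β) z (Sum.inl β) b)) CL₁ δ)
    (hL₂ : LocStencil₂ (fun κ u κ' u' => fun (x p : Site (d + 1)) (a : Fib d) (_ : Fib d) =>
      ∑ β : Fin (d + 1), (Z κ u κ' u' x p a (Sum.inl β) - Z κ u κ' u' x (p - unitVec β) a (Sum.inl β))) CL₂ δ) :
    LocStencil₂ (fun κ u κ' u' => comp (trK (psiKS r n)) (comp (slotPsiS r n (slotPsiS r n Z κ u) κ' u') (psiKS r n)) - Z κ u κ' u')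
      ((faceWtSum r n * (((n : ℝ) ^ (d + 1)) * (Real.exp (δ * (((d : ℝ) + 1) * n))
            * ((CL₁ * (1 + faceWtSum r n * (((d + 1 : ℕ) : ℝ) * (2 * (n : ℝ) ^ (d + 1))) * Real.exp (δ * (3 * (((d + 1 : ℕ) : ℝ) * n))))
                  * (1 + faceWtSum r n * (((d + 1 : ℕ) : ℝ) * (2 * (n : ℝ) ^ (d + 1))) * Real.exp (δ * (((d + 1 : ℕ) : ℝ) * n))))
              * (1 + faceWtSum r n * (((d : ℝ) + 1) * ((2 * (n : ℝ) ^ (d + 1)) * Real.exp (δ * (((d : ℝ) + 1) * n))))))))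
        + faceWtSum r n * (((n : ℝ) ^ (d + 1)) * (Real.exp (δ * (((d : ℝ) + 1) * n))
            * (CL₂ * (1 + faceWtSum r n * (((d + 1 : ℕ) : ℝ) * (2 * (n : ℝ) ^ (d + 1))) * Real.exp (δ * (3 * (((d + 1 : ℕ) : ℝ) * n))))
                  * (1 + faceWtSum r n * (((d + 1 : ℕ) : ℝ) * (2 * (n : ℝ) ^ (d + 1))) * Real.exp (δ * (((d + 1 : ℕ) : ℝ) * n)))))))
      + (faceWtSum r n * (((n : ℝ) ^ (d + 1)) * (Real.exp (3 * δ * (((d : ℝ) + 1) * n))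
            * (C₁ + faceWtSum r n * (((d : ℝ) + 1) * ((2 * (n : ℝ) ^ (d + 1)) * (Real.exp (δ * (((d : ℝ) + 1) * n)) * C₁))))))
          + faceWtSum r n * (((n : ℝ) ^ (d + 1)) * (Real.exp (δ * (((d : ℝ) + 1) * n)) * C₂)))) δ := by
  -- the leg defect of the slot-transported table, fed by the transported leg rows
  have hlegs := locStencil₂_legConj_sub_self_of_divergence_rows hn hr (fun κ u κ' u' => slotPsiS r n (slotPsiS r n Z κ u) κ' u') hδ
    (locStencil₂_legLeftRow_slotPsiS₂ hn Z hδ hL₁) (locStencil₂_legRightRow_slotPsiS₂ hn Z hδ hL₂)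
  -- the slot defect
  have hslots := locStencil₂_slotPsiS₂_sub_self_of_divergence_rows' (r := r) hn Z hδ h₁ h₂
  have h := locStencil₂_add' hlegs hslots
  intro κ u κ' u'
  change BiLoc (comp (trK (psiKS r n)) (comp (slotPsiS r n (slotPsiS r n Z κ u) κ' u') (psiKS r n)) - Z κ u κ' u') u u _ δ
  rw [(sub_add_sub_cancel (comp (trK (psiKS r n)) (comp (slotPsiS r n (slotPsiS r n Z κ u) κ' u') (psiKS r n)))
    (slotPsiS r n (slotPsiS r n Z κ u) κ' u') (Z κ u κ' u')).symm]
  exact h κ u κ' u'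

end Summit.QuantumFields.BalabanUV.Beta.GAN24.PsiTableDefectOfDivergences

end
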